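import Literature.NumberTheory.DiophantineGeometry.KodairaSymbol
import HarnessLib

/-!
# Kodaira symbols: characterisation of the additive types

Trunk `DiophValNum`; companion proof file of
`Literature.NumberTheory.DiophantineGeometry.KodairaSymbol` (theorems only).

`Literature.NumberTheory.DiophantineGeometry.KodairaSymbol.IsAdditive` is a *predicate* on Kodaira symbols — a definition with the body
`¬ k.IsGood ∧ ¬ k.IsMultiplicative`, of type `KodairaSymbol → Prop` (its header reads `: Prop`
only because `k` is a section variable) — and not a closed proposition: there is no well-typed
`IsAdditive_holds : IsAdditive`, and the universal closure `∀ k, k.IsAdditive` is false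
(`Literature.NumberTheory.DiophantineGeometry.KodairaSymbol.not_isAdditive_I`: `I₀` is good, `Iₙ`, `n ≥ 1`, is multiplicative).
What the literature does assert about the predicate is the classification made precise below:
in Tate's algorithm (Silverman, ATAEC IV, Algorithm 9.4) Step 1 exits with type `I₀` (good
reduction) and Step 2 with type `Iₙ`, `n = v(Δ) ≥ 1` (multiplicative reduction), after which
"from now on, `Ẽ` has a cusp and `Ẽ⁰(k) ≅ k⁺`", i.e. every remaining type
`II, III, IV, I₀*, Iₙ*, IV*, III*, II*` (Steps 3–10, Table 4.1) is of additive reduction.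

* `not_isAdditive_I` : no `Iₙ` (`n ≥ 0`) is additive;
* `isAdditive_iff_forall_ne_I` : additive iff not of type `Iₙ` for any `n`;
* `isAdditive_iff_not_isSemistable` : additive iff not semistable;
* `isAdditive_iff` : additive iff one of `II, III, IV, Iₙ* (n ≥ 0), IV*, III*, II*`
  (the "i.e." of the docstring of `IsAdditive`, as a theorem).

## References

* J. H. Silverman, *Advanced Topics in the Arithmetic of Elliptic Curves*, GTM 151, Springer 1994,
  §IV.9, Tate's Algorithm 9.4, Steps 1–2 and the sentence following Step 2; Table 4.1.
-/

namespace Literature.NumberTheory.DiophantineGeometry.KodairaSymbol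

variable (k : KodairaSymbol)

/-- No type `Iₙ` (`n ≥ 0`) is additive: `I₀` is good and `Iₙ`, `n ≥ 1`, is multiplicative
(Tate's algorithm, Steps 1–2). In particular `∀ k, k.IsAdditive` is false.
[cite: Silverman1994, §IV.9 Algorithm 9.4 Steps 1–2] -/
theorem not_isAdditive_I (n : ℕ) : ¬ (I n).IsAdditive := by
  rintro ⟨hg, hm⟩
  rcases n with _ | n
  · exact hg rfl
  · exact hm ⟨n + 1, n.succ_ne_zero, rfl⟩

/-- A Kodaira type is additive iff it is not of type `Iₙ` for any `n ≥ 0` (Tate's algorithm: the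
types returned after Step 2 are exactly the additive ones: "from now on, `Ẽ` has a cusp and
`Ẽ⁰(k) ≅ k⁺`"). [cite: Silverman1994, §IV.9 Algorithm 9.4 Steps 1–2] -/
theorem isAdditive_iff_forall_ne_I : k.IsAdditive ↔ ∀ n, k ≠ I n := by
  constructor
  · rintro h n rfl
    exact not_isAdditive_I n h
  · intro h
    refine ⟨fun hg => h 0 hg, ?_⟩
    rintro ⟨n, -, rfl⟩
    exact h n rfl

/-- Additive reduction type iff not semistable (semistable = good or multiplicative = type `Iₙ`).
[cite: Silverman1994, §IV.9 Algorithm 9.4 Steps 1–2] -/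
theorem isAdditive_iff_not_isSemistable : k.IsAdditive ↔ ¬ k.IsSemistable := by
  rw [IsAdditive, IsSemistable, not_or]

/-- The additive Kodaira types are exactly `II, III, IV, Iₙ* (n ≥ 0), IV*, III*, II*`, i.e. the
rows of Table 4.1 other than `I₀` and `Iₙ`. [cite: Silverman1994, §IV.9 Table 4.1] -/
theorem isAdditive_iff : k.IsAdditive ↔
    k = II ∨ k = III ∨ k = IV ∨ (∃ n, k = Istar n) ∨ k = IVstar ∨ k = IIIstar ∨ k = IIstar := by
  rw [isAdditive_iff_forall_ne_I]
  rcases k with n | _ | _ | _ | n | _ | _ | _ <;> simp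

end Literature.NumberTheory.DiophantineGeometry.KodairaSymbol
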